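import Mathlib
import HarnessLib
import Summits.HubbardSuperconductivity.HubbardSuperconductivity.Theorems.KLProgrammeKLRegimeSplitEdgeFactsShellOverlap

/-!
# Route `KLProgramme` — ENGINE child gen 8 (stmt-HubbardSuperconductivity-20437 `KLRegimeEngineV17F2`), skeleton v2 class #5 «(S)-transfer» rev 3 (RELATIVE
# family): the CUTOFF-BUILT (complementary) family — index-level facts (cell gate-hubbard-kl, seat hubbard-kl-p1 g13 = class-#5 text owner; EdgeFacts lane)

WHY.  Plan g20 (R54t)/(R54u) restrict the relative family `PairTransferRelFamily … n TB` (p585429) to a STEP-CLOSED, FRAME-COVARIANT, CONSUMER-COMPLETE sub-family;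
the text owner's pick (KL STATUS p1 g13, 2026-08-27T23:58Z) is the COMPLEMENTARY family: the members of record `s^K_{n,m} := softSymbolCompl K n m = w^K_{Λ_m} − w^K_{Λ_n}`,
`n ≤ m` (`m = n`: the PLAIN member `0`; `m > nScales β`: the WICK member `1 − w^K_{Λ_n}`), ordered pairs `(s_{n,m} | s_{n,m′})`, `n ≤ m′ ≤ m`.  This file supplies the
index-level facts that make the restriction work, as theorems about `softSymbolCompl` ONLY (no new definition — the predicate `IsCutoffBuilt` and the restricted
family Prop are the RelDefs author's `…EngineV8PairTransferRelDefsCB`, which can import this file):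

* §1 ALGEBRA (any frame `K`): `softSymbolCompl_self` (`s_{n,n} = 0`), the explicit RADIAL profile `softSymbolCompl_eq_profile` (`s_{n,m}(k) = χ₂(r²/Λ_m²) − χ₂(r²/Λ_n²)`,
  `r² = ω_k² + e_K(k)²`) and `softSymbolCompl_eq_of_radius_eq`, the TELESCOPING / HISTORY identity `softSymbolCompl_add_compl` (`s_{j,m} + s_{n,j} = s_{n,m}`; at `j = n+1`:
  the history of the member `(n+1, m)` is the member `(n, m)` — `softSymbolCompl_succ_add_slice`), the DIFFERENCE identity `softSymbolCompl_sub_compl`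
  (`s_{n,m} − s_{n,m′} = s_{m′,m}`: the difference of a family pair is the complementary symbol of the DEEPER scale `m′`), the ORDER `softSymbolCompl_mono_index`
  (`m′ ≤ m ⇒ s_{n,m′} ≤ s_{n,m}`), and the WICK member `softSymbolCompl_eq_one_sub_of_nScales_lt` (`m > nScales β ⇒ s_{n,m} = 1 − w^K_{Λ_n}`, since `|ω| ≥ π/β > Λ_m`).
* §2 MASSES AND OVERLAP of family pairs: the difference is admissible at the deeper scale (`isSoftSymbol_compl_sub_compl`), hence on a `FrameOK` frame with
  `klBetaMin ≤ β ≤ L` its soft mass at scale `n` is `≤ 15367·4^{−(m′−n)}` (`klSoftMass_compl_sub_compl_le_deep`, from p585429 `klSoftMass_le_deep`), and its born overlap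
  at scale `n` VANISHES as soon as `m′ ≥ n+1` (`klShellOverlap_compl_sub_compl_eq_zero`, from p586307 `klShellOverlap_eq_zero_of_soft_succ`) — the floor slot of
  `transferBarRelAtF` (k3c1-p1, `…RelBarF`) is live only on the PINNED pairs `(s_{n,m} | 0)`.
* §3 THE HISTORY PAIR: for `n+1 ≤ m′ ≤ m` the pair `(s_{n,m} | s_{n,m′})` (the history, at scale `n`, of `(s_{n+1,m} | s_{n+1,m′})`) is ordered, admissible at `(K, n)`,
  has the SAME difference, zero born overlap at `n`, and a quarter of the soft mass: `klSoftMass K n D = klSoftMass K (n+1) D / 4` (`historyPair_facts`,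
  `klSoftMass_historyPair_eq`).
Exact algebra over landed lemmas; nothing about the model's sizes is asserted; nothing asserts superconductivity.  0 kit · 0 lit.
-/

noncomputable section

namespace Summit.HubbardSuperconductivity.HubbardSuperconductivity.Theorems.KLRegimeSplit

set_option linter.dupNamespace false -- summit = problem name (single-conjunct summit), D-0017

open Real Finset Literature.MathematicalPhysics.QuantumLattice Literature.Probability.LatticeModels
open Summit.HubbardSuperconductivity.HubbardSuperconductivity.Theorems.KLProgrammeLegKernels
open Summit.HubbardSuperconductivity.HubbardSuperconductivity.Theorems.TwoPointAssembly

/-! ## §1 Algebra of the complementary family (any frame) -/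

section Algebra

variable {L M : ℕ} (β μ : ℝ) (K : TrigPolyC4v)

/-- **The PLAIN member**: `s_{n,n} = w_{Λ_n} − w_{Λ_n} = 0`. -/
theorem softSymbolCompl_self (n : ℕ) : softSymbolCompl L M β μ K n n = fun _ => 0 := by
  funext k
  simp [softSymbolCompl]

/-- **The explicit RADIAL profile** of a complementary symbol: `s_{n,m}(k) = χ₂((ω_k² + e_K(k)²)/Λ_m²) − χ₂((ω_k² + e_K(k)²)/Λ_n²)` (`χ₂ = salmhoferCutoff`) — a function of
`r² = ω² + e_K²` alone, through ONE explicit two-parameter Gevrey profile. -/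
theorem softSymbolCompl_eq_profile (n m : ℕ) (k : FreqMomentum L M) :
    softSymbolCompl L M β μ K n m k =
      salmhoferCutoff ((matsubaraFreq β M k.1 ^ 2 + nambuXiCT L μ K k.2 ^ 2) / klScale klE0 m ^ 2) -
        salmhoferCutoff ((matsubaraFreq β M k.1 ^ 2 + nambuXiCT L μ K k.2 ^ 2) / klScale klE0 n ^ 2) := rfl

/-- Hence complementary symbols are RADIAL in their frame: two modes with the same `ω² + e_K²` carry the same value. -/
theorem softSymbolCompl_eq_of_radius_eq (n m : ℕ) {k k' : FreqMomentum L M}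
    (h : matsubaraFreq β M k.1 ^ 2 + nambuXiCT L μ K k.2 ^ 2 = matsubaraFreq β M k'.1 ^ 2 + nambuXiCT L μ K k'.2 ^ 2) :
    softSymbolCompl L M β μ K n m k = softSymbolCompl L M β μ K n m k' := by
  rw [softSymbolCompl_eq_profile, softSymbolCompl_eq_profile, h]

/-- **TELESCOPING** (any frame, any indices): `s_{j,m} + s_{n,j} = s_{n,m}`. -/
theorem softSymbolCompl_add_compl (n j m : ℕ) : softSymbolCompl L M β μ K j m + softSymbolCompl L M β μ K n j = softSymbolCompl L M β μ K n m := by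
  funext k
  simp only [Pi.add_apply, softSymbolCompl]
  ring

/-- **THE HISTORY IDENTITY**: adding the slice symbol `s_{n,n+1}` to the member `(n+1, m)` gives the member `(n, m)` — `s_{n+1,m} + s_{n,n+1} = s_{n,m}`.  So the history
(at scale `n`) of the cutoff-built member of index `m` is the cutoff-built member of the SAME index: the family is closed under the step in every frame. -/
theorem softSymbolCompl_succ_add_slice (n m : ℕ) :
    softSymbolCompl L M β μ K (n + 1) m + softSymbolCompl L M β μ K n (n + 1) = softSymbolCompl L M β μ K n m :=
  softSymbolCompl_add_compl β μ K n (n + 1) m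

/-- Pointwise form of the history identity. -/
theorem softSymbolCompl_succ_add_slice_apply (n m : ℕ) (k : FreqMomentum L M) :
    softSymbolCompl L M β μ K (n + 1) m k + softSymbolCompl L M β μ K n (n + 1) k = softSymbolCompl L M β μ K n m k := by
  have h := congrFun (softSymbolCompl_succ_add_slice β μ K n m) k
  simpa only [Pi.add_apply] using h

/-- **THE DIFFERENCE IDENTITY**: `s_{n,m} − s_{n,m′} = s_{m′,m}` — the difference of a family pair is the complementary symbol of the DEEPER scale `m′` (any indices). -/
theorem softSymbolCompl_sub_compl (n m m' : ℕ) : softSymbolCompl L M β μ K n m - softSymbolCompl L M β μ K n m' = softSymbolCompl L M β μ K m' m := by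
  funext k
  simp only [Pi.sub_apply, softSymbolCompl]
  ring

/-- Pointwise form of the difference identity. -/
theorem softSymbolCompl_sub_compl_apply (n m m' : ℕ) (k : FreqMomentum L M) :
    softSymbolCompl L M β μ K n m k - softSymbolCompl L M β μ K n m' k = softSymbolCompl L M β μ K m' m k := by
  simp only [softSymbolCompl]
  ring

/-- The difference does not see the base scale: `s_{n,m} − s_{n,m′} = s_{j,m} − s_{j,m′}` for all `n, j`. -/
theorem softSymbolCompl_sub_compl_eq_sub (n j m m' : ℕ) :
    softSymbolCompl L M β μ K n m - softSymbolCompl L M β μ K n m' = softSymbolCompl L M β μ K j m - softSymbolCompl L M β μ K j m' := by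
  rw [softSymbolCompl_sub_compl, softSymbolCompl_sub_compl]

/-- **ORDER**: the family is totally ordered by the index — `m′ ≤ m ⇒ s_{n,m′} ≤ s_{n,m}` pointwise (`w_{Λ_{m′}} ≤ w_{Λ_m}`). -/
theorem softSymbolCompl_mono_index (n : ℕ) {m m' : ℕ} (h : m' ≤ m) (k : FreqMomentum L M) :
    softSymbolCompl L M β μ K n m' k ≤ softSymbolCompl L M β μ K n m k := by
  have := hubbardCutoffWeightCT_klScale_mono (L := L) β μ K h k
  unfold softSymbolCompl
  linarith

/-- The difference of an ordered family pair is pointwise nonnegative. -/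
theorem softSymbolCompl_sub_compl_nonneg (n : ℕ) {m m' : ℕ} (h : m' ≤ m) (k : FreqMomentum L M) :
    0 ≤ softSymbolCompl L M β μ K n m k - softSymbolCompl L M β μ K n m' k := by
  linarith [softSymbolCompl_mono_index β μ K n h k]

/-- **THE WICK MEMBER**: past the thermal index every mode is above the scale (`|ω_k| ≥ π/β > Λ_m` for `m > nScales β`), so `w^K_{Λ_m} ≡ 1` and
`s_{n,m} = 1 − w^K_{Λ_n}` — the member whose covariance is `D^K_n` itself (`softCovOf_self`). -/
theorem softSymbolCompl_eq_one_sub_of_nScales_lt {β : ℝ} (hβ : 0 < β) (μ : ℝ) (K : TrigPolyC4v) (n : ℕ) {m : ℕ} (hm : nScales β < m) :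
    softSymbolCompl L M β μ K n m = fun k => 1 - hubbardCutoffWeightCT L M β μ K (klScale klE0 n) k := by
  funext k
  have hΛ : 0 < klScale klE0 m := klth_klScale_pos m
  have h1 : hubbardCutoffWeightCT L M β μ K (klScale klE0 m) k = 1 := by
    unfold hubbardCutoffWeightCT
    apply salmhoferCutoff_of_ge
    rw [le_div_iff₀ (by positivity), one_mul]
    have hω : klScale klE0 m ≤ |matsubaraFreq β M k.1| :=
      ((klth_klScale_lt_pi_div hβ hm).le).trans (Literature.MathematicalPhysics.QuantumLattice.pi_div_le_abs_matsubaraFreq hβ k.1)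
    have h2 : klScale klE0 m ^ 2 ≤ matsubaraFreq β M k.1 ^ 2 := by
      rw [← sq_abs (matsubaraFreq β M k.1)]
      exact pow_le_pow_left₀ hΛ.le hω 2
    nlinarith [sq_nonneg (nambuXiCT L μ K k.2)]
  unfold softSymbolCompl
  rw [h1]

end Algebra

/-! ## §2 Masses and born overlap of family pairs -/

section Masses

variable {L M : ℕ} [NeZero L] (β μ : ℝ) (K : TrigPolyC4v)

omit [NeZero L] in
/-- The difference of the family pair `(s_{n,m} | s_{n,m′})`, `m′ ≤ m`, is ADMISSIBLE AT THE DEEPER SCALE `m′` (it is `s_{m′,m}`). -/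
theorem isSoftSymbol_compl_sub_compl (n : ℕ) {m m' : ℕ} (h : m' ≤ m) :
    IsSoftSymbol L M β μ K m' (softSymbolCompl L M β μ K n m - softSymbolCompl L M β μ K n m') := by
  rw [softSymbolCompl_sub_compl]
  exact isSoftSymbol_compl β μ K h

omit [NeZero L] in
/-- … and (a fortiori) admissible at every scale `j ≤ m′`, in particular at the pair's own scale `n ≤ m′`. -/
theorem isSoftSymbol_compl_sub_compl_of_le {j m m' : ℕ} (n : ℕ) (hj : j ≤ m') (h : m' ≤ m) :
    IsSoftSymbol L M β μ K j (softSymbolCompl L M β μ K n m - softSymbolCompl L M β μ K n m') := by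
  rw [softSymbolCompl_sub_compl, ← softSymbolCompl_sub_compl β μ K j m m']
  exact isSoftSymbol_sub_of_ordered β μ K (isSoftSymbol_compl β μ K (hj.trans h)) (isSoftSymbol_compl β μ K hj)
    (softSymbolCompl_mono_index β μ K j h)

omit [NeZero L] in
/-- Pointwise bounds of the difference: `0 ≤ s_{n,m} − s_{n,m′} ≤ 1 − w^K_{Λ_{m′}}` (`m′ ≤ m`). -/
theorem softSymbolCompl_sub_compl_mem (n : ℕ) {m m' : ℕ} (h : m' ≤ m) (k : FreqMomentum L M) :
    0 ≤ (softSymbolCompl L M β μ K n m - softSymbolCompl L M β μ K n m') k ∧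
      (softSymbolCompl L M β μ K n m - softSymbolCompl L M β μ K n m') k ≤ 1 - hubbardCutoffWeightCT L M β μ K (klScale klE0 m') k :=
  (isSoftSymbol_compl_sub_compl β μ K n h).1 k

variable {R : RenConsts} {U : ℝ} {N : ℕ}

/-- **DEEP MASS OF A FAMILY PAIR'S DIFFERENCE**: on a `FrameOK` frame with `klBetaMin ≤ β ≤ L`, for `n ≤ m′ ≤ m`,
`klSoftMass K n (s_{n,m} − s_{n,m′}) ≤ 15367·4^{−(m′−n)}` — the relative bar of a pair whose members first differ at the deep shell `m′` is correspondingly small. -/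
theorem klSoftMass_compl_sub_compl_le_deep (hK : FrameOK R U N μ K) (hβ : klBetaMin ≤ β) (hβL : β ≤ L) {n m m' : ℕ} (hn : n ≤ m') (h : m' ≤ m) :
    klSoftMass L M β μ K n (softSymbolCompl L M β μ K n m - softSymbolCompl L M β μ K n m') ≤ 15367 * ((4 : ℝ) ^ (m' - n))⁻¹ :=
  klSoftMass_le_deep hK hβ hβL hn (softSymbolCompl_sub_compl_mem β μ K n h)

/-- The coarse form at the pair's own scale: `klSoftMass K n (s_{n,m} − s_{n,m′}) ≤ 15367` (`n ≤ m′ ≤ m`). -/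
theorem klSoftMass_compl_sub_compl_le (hK : FrameOK R U N μ K) (hβ : klBetaMin ≤ β) (hβL : β ≤ L) {n m m' : ℕ} (hn : n ≤ m') (h : m' ≤ m) :
    klSoftMass L M β μ K n (softSymbolCompl L M β μ K n m - softSymbolCompl L M β μ K n m') ≤ 15367 := by
  refine (klSoftMass_compl_sub_compl_le_deep β μ K hK hβ hβL hn h).trans ?_
  have h4 : (1 : ℝ) ≤ (4 : ℝ) ^ (m' - n) := one_le_pow₀ (by norm_num)
  have : ((4 : ℝ) ^ (m' - n))⁻¹ ≤ 1 := inv_le_one_of_one_le₀ h4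
  nlinarith

/-- The mass of a single MEMBER at its own scale: `klSoftMass K n (s_{n,m}) ≤ 15367` (`n ≤ m`; the pinned pair `(s_{n,m} | 0)`). -/
theorem klSoftMass_compl_le (hK : FrameOK R U N μ K) (hβ : klBetaMin ≤ β) (hβL : β ≤ L) {n m : ℕ} (hnm : n ≤ m) :
    klSoftMass L M β μ K n (softSymbolCompl L M β μ K n m) ≤ 15367 :=
  klSoftMass_le_of_isSoftSymbol hK hβ hβL (isSoftSymbol_compl β μ K hnm)

/-- **THE BORN OVERLAP OF A NON-PINNED FAMILY PAIR VANISHES**: for `n + 1 ≤ m′ ≤ m`, `klShellOverlap K n (s_{n,m} − s_{n,m′}) = 0` — the difference `s_{m′,m}` lives on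
`ω² + e_K² < Λ_{m′}² ≤ Λ_n²/16`, below the scale-`n` band `[Λ_n²/4, Λ_n²]`.  So the floor slot of the relative bar is live only on the pinned pairs `(s_{n,m} | 0)`. -/
theorem klShellOverlap_compl_sub_compl_eq_zero {n m m' : ℕ} (hn : n + 1 ≤ m') (h : m' ≤ m) :
    klShellOverlap L M β μ K n (softSymbolCompl L M β μ K n m - softSymbolCompl L M β μ K n m') = 0 :=
  klShellOverlap_eq_zero_of_soft_succ β μ K n fun k => by
    obtain ⟨h0, h1⟩ := softSymbolCompl_sub_compl_mem β μ K n h k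
    rw [abs_of_nonneg h0]
    exact h1.trans (by linarith [hubbardCutoffWeightCT_klScale_mono (L := L) β μ K hn k])

/-- The born overlap of ANY family pair at its own scale is at most `15367` (`n ≤ m′ ≤ m`; relevant only for the pinned pairs `m′ = n`). -/
theorem klShellOverlap_compl_sub_compl_le (hK : FrameOK R U N μ K) (hβ : klBetaMin ≤ β) (hβL : β ≤ L) {n m m' : ℕ} (hn : n ≤ m') (h : m' ≤ m) :
    klShellOverlap L M β μ K n (softSymbolCompl L M β μ K n m - softSymbolCompl L M β μ K n m') ≤ 15367 :=
  (klShellOverlap_le_klSoftMass β μ K (pos_of_klBetaMin_le hβ) n _).trans (klSoftMass_compl_sub_compl_le β μ K hK hβ hβL hn h)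

end Masses

/-! ## §3 The history pair -/

section History

variable {L M : ℕ} [NeZero L] (β μ : ℝ) (K : TrigPolyC4v)

/-- **History bookkeeping** (one frame `K`): for `n + 1 ≤ m′ ≤ m`, the pair `(s_{n,m} | s_{n,m′})` — the scale-`n` history of the pair `(s_{n+1,m} | s_{n+1,m′})`, obtained by
adding the slice symbol `s_{n,n+1}` to both members — is ORDERED, both members are admissible at `(K, n)`, its difference EQUALS the deeper pair's difference, and its born
overlap at scale `n` is `0`. -/
theorem historyPair_facts {n m m' : ℕ} (hn : n + 1 ≤ m') (h : m' ≤ m) :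
    softSymbolCompl L M β μ K (n + 1) m + softSymbolCompl L M β μ K n (n + 1) = softSymbolCompl L M β μ K n m ∧
    softSymbolCompl L M β μ K (n + 1) m' + softSymbolCompl L M β μ K n (n + 1) = softSymbolCompl L M β μ K n m' ∧
    IsSoftSymbol L M β μ K n (softSymbolCompl L M β μ K n m) ∧ IsSoftSymbol L M β μ K n (softSymbolCompl L M β μ K n m') ∧
    (∀ k, softSymbolCompl L M β μ K n m' k ≤ softSymbolCompl L M β μ K n m k) ∧
    softSymbolCompl L M β μ K n m - softSymbolCompl L M β μ K n m' = softSymbolCompl L M β μ K (n + 1) m - softSymbolCompl L M β μ K (n + 1) m' ∧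
    klShellOverlap L M β μ K n (softSymbolCompl L M β μ K n m - softSymbolCompl L M β μ K n m') = 0 :=
  ⟨softSymbolCompl_succ_add_slice β μ K n m, softSymbolCompl_succ_add_slice β μ K n m',
    isSoftSymbol_compl β μ K ((Nat.le_succ n).trans (hn.trans h)), isSoftSymbol_compl β μ K ((Nat.le_succ n).trans hn),
    fun k => softSymbolCompl_mono_index β μ K n h k, softSymbolCompl_sub_compl_eq_sub β μ K n (n + 1) m m',
    klShellOverlap_compl_sub_compl_eq_zero β μ K hn h⟩

/-- **THE CONTRACTION on the family** (one frame): the history pair carries a QUARTER of the soft mass of the deeper pair — `klSoftMass K n (s_{n,m} − s_{n,m′}) =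
klSoftMass K (n+1) (s_{n+1,m} − s_{n+1,m′}) / 4` (same difference, `klSoftMass_succ`). -/
theorem klSoftMass_historyPair_eq (n m m' : ℕ) :
    klSoftMass L M β μ K n (softSymbolCompl L M β μ K n m - softSymbolCompl L M β μ K n m') =
      klSoftMass L M β μ K (n + 1) (softSymbolCompl L M β μ K (n + 1) m - softSymbolCompl L M β μ K (n + 1) m') / 4 := by
  rw [softSymbolCompl_sub_compl_eq_sub β μ K n (n + 1) m m', klSoftMass_succ]
  ring

end History

end Summit.HubbardSuperconductivity.HubbardSuperconductivity.Theorems.KLRegimeSplit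

end
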